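import Summits.CriticalPhenomena.PercolationContinuityZ3.Theorems.PercNearOneGluingNoHeavyLowerTailSahiCombMixMixedCells

/-!
# MIXED one-coordinate steps over FOUR events: the six singleton cells are closed identities with manifestly nonnegative pieces

Support file of the one-cut programme (crux `NoHeavyLowerTail`, stmt-CriticalPhenomena-4575; cell `prim-masterthm`, seat P3, gen 9;
`run/shared/lean/prim/prim-masterthm/prim-masterthm-p3/HIERARCHY.md` §17(h),(i)).  Vocabulary: `coinWeight`, `BernsteinPos` (`…SahiMixtureLaw`), the mixed coin event
`SahiCombMix.orAndCoin A b₁ b₂` (`b₁`: OR the coin in; else `b₂`: AND it in; else untouched) of `…SahiCombMixMixedCells`, Sahi's printed `E_3`, `E_4` (`sahiE_three`, `sahiE_four`).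

After OR/AND-mixing one coin into FOUR events, the top row `E_4` of each of the six singleton patterns with both an OR- and an AND-member is a polynomial in `h` in the basis
`h, h(1−h), h(1−h)(2−h), h(1−h)(2−h)(3−h)` (all Bernstein-positive) whose coefficients are manifestly nonnegative combinations of hereditary rows of the UNMIXED members
(`E_3`, `Cov`) times probabilities — found by the tensor/complement expansion (seat folder work/mixed/tensor4.py) and checked exactly against brute force (verify6.py);
the LP route (kit j121646) certifies the same cells but with dense certificates.  With `a = μ(A)`, `ab = μ(A∩B)`, … :
* `sahiE_four_OAPP_eq`  `E_4(A∪H, B∩H, C, D) = 2h·E_3(B,C,D) + h(1−h)[(1−a)E_3(B,C,D) + Cov(B,C)(d−ad) + Cov(B,D)(c−ac) + 2b(cd−acd)]`;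
* `sahiE_four_OOAP_eq`, `sahiE_four_OAAP_eq`, `sahiE_four_OAAA_eq`, `sahiE_four_OOAA_eq`, `sahiE_four_OOOA_eq` — see the statements; OOOA (like the three-event OOA cell)
  needs NO positivity hypothesis, OOAP/OOAA only `Cov(C,D) ≥ 0`, the others `E_3(B,C,D)` and covariances of `B,C,D`.
This file records the IDENTITIES (pure `ring` facts about any weight of total mass one); the comb-level lift (through `SahiCombMix.sahiE_orAndCoord_eq_coin`, every
piece a hereditary comb row or Venn moment off `e`) and the dispatch over all selector patterns = the interface `SahiCombMix.CombFourSingletonMixedCells` of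
`…SahiCombMixMixedFour` are the sequel `…SahiCombMixMixedFourSingle`.  HONEST FRAMING: four-event singleton cells only; nothing about Sahi's `C_k` in general. [this work]
-/

noncomputable section

open scoped Classical

namespace Summit.CriticalPhenomena.PercolationContinuityZ3.Theorems

open Finset Function
open Literature.Combinatorics.Sahi2008
open Literature.Probability.Percolation.BHK2006 (ind_le_one)
open Literature.Probability.Percolation.DecisionTree (ind ind_of_mem ind_of_not_mem ind_nonneg)
open SahiCombMix (orAndCoin)

namespace SahiMixture

variable {α : Type*} [Fintype α]

/-! ### Coin moments of mixed (OR/AND) coin events -/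

omit [Fintype α] in
/-- Off the coin: an OR-member is `A`, an AND-member is `∅`, an untouched member is `A`. [this work] -/
@[simp] theorem ind_orAndCoin_false (A : Set α) (b c : Bool) (a : α) :
    ind (orAndCoin A b c) (a, false) = bif (!b && c) then 0 else ind A a := by
  unfold SahiCombMix.orAndCoin
  cases b <;> cases c <;> simp

omit [Fintype α] in
/-- On the coin: an OR-member is everything, the others are `A`. [this work] -/
@[simp] theorem ind_orAndCoin_true (A : Set α) (b c : Bool) (a : α) :
    ind (orAndCoin A b c) (a, true) = bif b then 1 else ind A a := by
  unfold SahiCombMix.orAndCoin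
  cases b <;> cases c <;> simp

/-- The off-coin factor of a mixed member as a function. [this work] -/
def offF (A : Set α) (b c : Bool) : α → ℝ := bif (!b && c) then 0 else ind A
/-- The on-coin factor of a mixed member as a function. [this work] -/
def onF (A : Set α) (b : Bool) : α → ℝ := bif b then 1 else ind A

omit [Fintype α] in
/-- Pointwise value of the off-coin factor. [this work] -/
theorem offF_apply (A : Set α) (b c : Bool) (a : α) : offF A b c a = bif (!b && c) then 0 else ind A a := by
  unfold offF; cases (!b && c) <;> rfl
omit [Fintype α] in
/-- Pointwise value of the on-coin factor. [this work] -/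
theorem onF_apply (A : Set α) (b : Bool) (a : α) : onF A b a = bif b then 1 else ind A a := by
  unfold onF; cases b <;> rfl

section Moments

variable (μ : α → ℝ) (h : ℝ)

/-- First coin moment of a mixed member. [this work] -/
theorem exc_orAnd₁ (X : Set α) (b₁ c₁ : Bool) :
    ex (coinWeight μ h) (ind (orAndCoin X b₁ c₁)) = (1 - h) * ex μ (offF X b₁ c₁) + h * ex μ (onF X b₁) := by
  rw [ex_coinWeight]
  congr 2 <;> (congr 1; funext a; simp [offF_apply, onF_apply])

/-- Second coin moment of mixed members. [this work] -/
theorem exc_orAnd₂ (X Y : Set α) (b₁ c₁ b₂ c₂ : Bool) :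
    ex (coinWeight μ h) (ind (orAndCoin X b₁ c₁) * ind (orAndCoin Y b₂ c₂))
      = (1 - h) * ex μ (offF X b₁ c₁ * offF Y b₂ c₂) + h * ex μ (onF X b₁ * onF Y b₂) := by
  rw [ex_coinWeight]
  congr 2 <;> (congr 1; funext a; simp [offF_apply, onF_apply])

/-- Third coin moment of mixed members. [this work] -/
theorem exc_orAnd₃ (X Y Z : Set α) (b₁ c₁ b₂ c₂ b₃ c₃ : Bool) :
    ex (coinWeight μ h) (ind (orAndCoin X b₁ c₁) * ind (orAndCoin Y b₂ c₂) * ind (orAndCoin Z b₃ c₃))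
      = (1 - h) * ex μ (offF X b₁ c₁ * offF Y b₂ c₂ * offF Z b₃ c₃) + h * ex μ (onF X b₁ * onF Y b₂ * onF Z b₃) := by
  rw [ex_coinWeight]
  congr 2 <;> (congr 1; funext a; simp [offF_apply, onF_apply])

/-- Fourth coin moment of mixed members. [this work] -/
theorem exc_orAnd₄ (X Y Z W : Set α) (b₁ c₁ b₂ c₂ b₃ c₃ b₄ c₄ : Bool) :
    ex (coinWeight μ h) (ind (orAndCoin X b₁ c₁) * ind (orAndCoin Y b₂ c₂) * ind (orAndCoin Z b₃ c₃) * ind (orAndCoin W b₄ c₄))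
      = (1 - h) * ex μ (offF X b₁ c₁ * offF Y b₂ c₂ * offF Z b₃ c₃ * offF W b₄ c₄) + h * ex μ (onF X b₁ * onF Y b₂ * onF Z b₃ * onF W b₄) := by
  rw [ex_coinWeight]
  congr 2 <;> (congr 1; funext a; simp [offF_apply, onF_apply])

end Moments

/-! ### The six singleton cells -/

section Cells

variable {μ : α → ℝ} (hμ : ∀ a, 0 ≤ μ a) (hμ1 : ∑ a, μ a = 1) (A B C D : Set α)
include hμ1

set_option maxHeartbeats 800000 in
/-- **OAPP**: `E_4(A∪H, B∩H, C, D)`. [this work] -/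
theorem sahiE_four_OAPP_eq (h : ℝ) :
    sahiE (coinWeight μ h) 4 ![ind (orAndCoin A true false), ind (orAndCoin B false true), ind (orAndCoin C false false), ind (orAndCoin D false false)]
      = h * (2 * sahiE μ 3 ![ind B, ind C, ind D])
        + h * (1 - h) * ((1 - ex μ (ind A)) * sahiE μ 3 ![ind B, ind C, ind D]
            + (ex μ (ind B * ind C) - ex μ (ind B) * ex μ (ind C)) * (ex μ (ind D) - ex μ (ind A * ind D))
            + (ex μ (ind B * ind D) - ex μ (ind B) * ex μ (ind D)) * (ex μ (ind C) - ex μ (ind A * ind C))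
            + 2 * ex μ (ind B) * (ex μ (ind C * ind D) - ex μ (ind A * ind C * ind D))) := by
  rw [sahiE_four, sahiE_three]
  simp only [exc_orAnd₄, exc_orAnd₃, exc_orAnd₂, exc_orAnd₁, offF, onF, Bool.not_true, Bool.not_false, Bool.true_and, Bool.false_and,
    cond_true, cond_false, mul_one, one_mul, mul_zero, zero_mul, ex_zero_fun, ex_one hμ1]
  ring

set_option maxHeartbeats 800000 in
/-- **OOAP**: `E_4(A∪H, B∪H, C∩H, D)`. [this work] -/
theorem sahiE_four_OOAP_eq (h : ℝ) :
    sahiE (coinWeight μ h) 4 ![ind (orAndCoin A true false), ind (orAndCoin B true false), ind (orAndCoin C false true), ind (orAndCoin D false false)]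
      = h * (2 * (ex μ (ind C * ind D) - ex μ (ind C) * ex μ (ind D)))
        + h * (1 - h) * ((ex μ (ind C * ind D) - ex μ (ind C) * ex μ (ind D)) * (2 - ex μ (ind A * ind B) - ex μ (ind A) * ex μ (ind B))
            + ex μ (ind C) * ((ex μ (ind A * ind D) - ex μ (ind A * ind B * ind D)) * (1 - ex μ (ind B))
              + (ex μ (ind B * ind D) - ex μ (ind A * ind B * ind D)) * (1 - ex μ (ind A))
              + (ex μ (ind A) + ex μ (ind B)) * (ex μ (ind D) - ex μ (ind A * ind B * ind D))))
        + h * (1 - h) * (2 - h) * ((1 - ex μ (ind A)) * (1 - ex μ (ind B)) * (ex μ (ind C * ind D) - ex μ (ind C) * ex μ (ind D))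
            + ex μ (ind C) * ((1 - ex μ (ind A)) * (ex μ (ind D) - ex μ (ind B * ind D)) + (1 - ex μ (ind B)) * (ex μ (ind D) - ex μ (ind A * ind D)))) := by
  rw [sahiE_four]
  simp only [exc_orAnd₄, exc_orAnd₃, exc_orAnd₂, exc_orAnd₁, offF, onF, Bool.not_true, Bool.not_false, Bool.true_and, Bool.false_and,
    cond_true, cond_false, mul_one, one_mul, mul_zero, zero_mul, ex_zero_fun, ex_one hμ1]
  ring

set_option maxHeartbeats 800000 in
/-- **OAAP**: `E_4(A∪H, B∩H, C∩H, D)`. [this work] -/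
theorem sahiE_four_OAAP_eq (h : ℝ) :
    sahiE (coinWeight μ h) 4 ![ind (orAndCoin A true false), ind (orAndCoin B false true), ind (orAndCoin C false true), ind (orAndCoin D false false)]
      = h * (2 * sahiE μ 3 ![ind B, ind C, ind D])
        + h * (1 - h) * ((1 - ex μ (ind A)) * sahiE μ 3 ![ind B, ind C, ind D]
            + (ex μ (ind B * ind C) - ex μ (ind B) * ex μ (ind C)) * (ex μ (ind D) - ex μ (ind A * ind D))
            + (1 + ex μ (ind A)) * ((ex μ (ind B * ind D) - ex μ (ind B) * ex μ (ind D)) * ex μ (ind C)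
              + (ex μ (ind C * ind D) - ex μ (ind C) * ex μ (ind D)) * ex μ (ind B))
            + ex μ (ind B) * ex μ (ind C) * (ex μ (ind A * ind D) + ex μ (ind A) * ex μ (ind D)))
        + h * (1 - h) * (2 - h) * ((1 - ex μ (ind A)) * ((ex μ (ind B * ind D) - ex μ (ind B) * ex μ (ind D)) * ex μ (ind C)
              + (ex μ (ind C * ind D) - ex μ (ind C) * ex μ (ind D)) * ex μ (ind B))
            + ex μ (ind B) * ex μ (ind C) * ((ex μ (ind D) - ex μ (ind A * ind D)) + ex μ (ind D) * (1 - ex μ (ind A)))) := by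
  rw [sahiE_four, sahiE_three]
  simp only [exc_orAnd₄, exc_orAnd₃, exc_orAnd₂, exc_orAnd₁, offF, onF, Bool.not_true, Bool.not_false, Bool.true_and, Bool.false_and,
    cond_true, cond_false, mul_one, one_mul, mul_zero, zero_mul, ex_zero_fun, ex_one hμ1]
  ring

set_option maxHeartbeats 800000 in
/-- **OAAA**: `E_4(A∪H, B∩H, C∩H, D∩H)`. [this work] -/
theorem sahiE_four_OAAA_eq (h : ℝ) :
    sahiE (coinWeight μ h) 4 ![ind (orAndCoin A true false), ind (orAndCoin B false true), ind (orAndCoin C false true), ind (orAndCoin D false true)]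
      = h * (2 * sahiE μ 3 ![ind B, ind C, ind D])
        + h * (1 - h) * ((1 - ex μ (ind A)) * sahiE μ 3 ![ind B, ind C, ind D]
            + (1 + ex μ (ind A)) * ((ex μ (ind B * ind C) - ex μ (ind B) * ex μ (ind C)) * ex μ (ind D)
              + (ex μ (ind B * ind D) - ex μ (ind B) * ex μ (ind D)) * ex μ (ind C)
              + (ex μ (ind C * ind D) - ex μ (ind C) * ex μ (ind D)) * ex μ (ind B)))
        + h * (1 - h) * (2 - h) * ((1 - ex μ (ind A)) * ((ex μ (ind B * ind C) - ex μ (ind B) * ex μ (ind C)) * ex μ (ind D)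
              + (ex μ (ind B * ind D) - ex μ (ind B) * ex μ (ind D)) * ex μ (ind C)
              + (ex μ (ind C * ind D) - ex μ (ind C) * ex μ (ind D)) * ex μ (ind B))
            + 2 * ex μ (ind A) * ex μ (ind B) * ex μ (ind C) * ex μ (ind D))
        + h * (1 - h) * (2 - h) * (3 - h) * (ex μ (ind B) * ex μ (ind C) * ex μ (ind D) * (1 - ex μ (ind A))) := by
  rw [sahiE_four, sahiE_three]
  simp only [exc_orAnd₄, exc_orAnd₃, exc_orAnd₂, exc_orAnd₁, offF, onF, Bool.not_true, Bool.not_false, Bool.true_and, Bool.false_and,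
    cond_true, cond_false, mul_one, one_mul, mul_zero, ex_zero_fun, ex_one hμ1]
  ring

set_option maxHeartbeats 800000 in
/-- **OOAA**: `E_4(A∪H, B∪H, C∩H, D∩H)`. [this work] -/
theorem sahiE_four_OOAA_eq (h : ℝ) :
    sahiE (coinWeight μ h) 4 ![ind (orAndCoin A true false), ind (orAndCoin B true false), ind (orAndCoin C false true), ind (orAndCoin D false true)]
      = h * (2 * (ex μ (ind C * ind D) - ex μ (ind C) * ex μ (ind D)))
        + h * (1 - h) * ((ex μ (ind C * ind D) - ex μ (ind C) * ex μ (ind D)) * (2 - ex μ (ind A * ind B) - ex μ (ind A) * ex μ (ind B))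
            + ex μ (ind C) * ex μ (ind D) * (ex μ (ind A * ind B) + ex μ (ind A) * ex μ (ind B)))
        + h * (1 - h) * (2 - h) * ((ex μ (ind C * ind D) - ex μ (ind C) * ex μ (ind D)) * ((1 - ex μ (ind A)) * (1 - ex μ (ind B)))
            + ex μ (ind C) * ex μ (ind D) * ((ex μ (ind A) + ex μ (ind B) - ex μ (ind A * ind B) - ex μ (ind A) * ex μ (ind B))
              + ex μ (ind A) * (1 - ex μ (ind B)) + ex μ (ind B) * (1 - ex μ (ind A))))
        + h * (1 - h) * (2 - h) * (3 - h) * (ex μ (ind C) * ex μ (ind D) * ((1 - ex μ (ind A)) * (1 - ex μ (ind B)))) := by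
  rw [sahiE_four]
  simp only [exc_orAnd₄, exc_orAnd₃, exc_orAnd₂, exc_orAnd₁, offF, onF, Bool.not_true, Bool.not_false, Bool.true_and, Bool.false_and,
    cond_true, cond_false, mul_one, one_mul, mul_zero, ex_zero_fun, ex_one hμ1]
  ring

set_option maxHeartbeats 800000 in
/-- **OOOA**: `E_4(A∪H, B∪H, C∪H, D∩H)` — no positivity hypothesis at all. [this work] -/
theorem sahiE_four_OOOA_eq (h : ℝ) :
    sahiE (coinWeight μ h) 4 ![ind (orAndCoin A true false), ind (orAndCoin B true false), ind (orAndCoin C true false), ind (orAndCoin D false true)]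
      = h * (1 - h) * (ex μ (ind D) * ((ex μ (ind A * ind B) - ex μ (ind A * ind B * ind C)) + (ex μ (ind A * ind C) - ex μ (ind A * ind B * ind C))
            + ex μ (ind B * ind C) * (1 - ex μ (ind A)) + ex μ (ind C) * (ex μ (ind A) - ex μ (ind A * ind B))
            + ex μ (ind B) * (ex μ (ind C) - ex μ (ind A * ind C)) + ex μ (ind A) * ex μ (ind B) * (1 - ex μ (ind C))))
        + h * (1 - h) * (2 - h) * (ex μ (ind D) * (ex μ (ind A) * (1 - ex μ (ind B)) * (1 - ex μ (ind C))
            + ex μ (ind B) * (1 - ex μ (ind A)) * (1 - ex μ (ind C)) + ex μ (ind C) * (1 - ex μ (ind A)) * (1 - ex μ (ind B))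
            + (ex μ (ind A) - ex μ (ind A * ind B)) * (1 - ex μ (ind C)) + (ex μ (ind B) - ex μ (ind B * ind C)) * (1 - ex μ (ind A))
            + (ex μ (ind C) - ex μ (ind A * ind C)) * (1 - ex μ (ind B))))
        + h * (1 - h) * (2 - h) * (3 - h) * (ex μ (ind D) * ((1 - ex μ (ind A)) * (1 - ex μ (ind B)) * (1 - ex μ (ind C)))) := by
  rw [sahiE_four]
  simp only [exc_orAnd₄, exc_orAnd₃, exc_orAnd₂, exc_orAnd₁, offF, onF, Bool.not_true, Bool.not_false, Bool.true_and, Bool.false_and,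
    cond_true, cond_false, mul_one, one_mul, mul_zero, ex_zero_fun, ex_one hμ1]
  ring

end Cells

end SahiMixture

end Summit.CriticalPhenomena.PercolationContinuityZ3.Theorems

end
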